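import Literature.Probability.LatticeModels.DomainDiscretisation
import Literature.Probability.LatticeModels.ThermodynamicLimit
import HarnessLib

/-!
# Tao's log-averaged Elliott theorem: the discretisation `g ↦ g_{ε²}` takes `O_ε(1)` values

Part of the proof DAG below the named fact `Literature.NumberTheory.LFunctions.Tao2016_theorem23_core` (Tao, Forum Math. Pi 4
(2016) e8, the proof of Theorem 2.3).  Before the entropy decrement argument the paper performs "a
standard discretisation" (§2, the paragraph after the proof of Proposition 2.6): `g_{i,ε²}(n)` is
`g_i(n)` rounded to the nearest element of the lattice `ε² ℤ[i]`, so that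
`X_H = (g_{i,ε²}(an+j))_{i,j}` takes finitely many values ("it takes at most `O_ε(1)` values, it
is bounded in magnitude by `O(1)`, and we have `g_{i,ε²} = g_i + O(ε²)`").

The rounding itself is already in the tree: `Literature.StatMech.nearestSite δ z : Site 2` (the site of
`ℤ²` nearest to `z/δ`, `Literature/Probability/LatticeModels/DomainDiscretisation.lean`) with
mesh point `Literature.StatMech.meshPoint δ (nearestSite δ z) ∈ δℤ[i] ⊆ ℂ`, and
`dist_meshPoint_nearestSite_le` is `g_{ε²} = g + O(ε²)` (error `≤ δ`).  This file adds the two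
remaining quoted properties, phrased on those survivors:

* `nearestSite_mem_box` — for `‖z‖ ≤ 1`, `nearestSite δ z ∈ Literature.StatMech.box 2 (⌈1/δ⌉₊ + 1)`
  ("at most `O_ε(1)` values": `(2(⌈1/δ⌉+1)+1)²` of them, `Literature.Probability.LatticeModels.card_box`);
* `norm_meshPoint_nearestSite_le` — `‖meshPoint δ (nearestSite δ z)‖ ≤ ‖z‖ + δ` ("bounded in
  magnitude by `O(1)`").

## References
* T. Tao, Forum Math. Pi 4 (2016), e8; arXiv:1509.05422, §2, the paragraph following the proof
  of Proposition 2.6.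
-/

open Complex

namespace Literature.NumberTheory.LFunctions

namespace Tao2016

open Literature.Probability.LatticeModels

/-- The rounded coordinate of a real number of absolute value `≤ 1` at mesh `δ > 0` is at most
`⌈1/δ⌉ + 1` in absolute value. [folklore] -/
theorem abs_round_div_le {δ : ℝ} (hδ : 0 < δ) {t : ℝ} (ht : |t| ≤ 1) :
    |round (t / δ)| ≤ (⌈1 / δ⌉₊ : ℤ) + 1 := by
  have h1 : |(round (t / δ) : ℝ)| ≤ |t / δ| + 1 / 2 := by
    have h := abs_sub_round (t / δ)
    have := abs_sub_abs_le_abs_sub (round (t / δ) : ℝ) (t / δ)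
    rw [abs_sub_comm] at this
    linarith
  have h2 : |t / δ| ≤ 1 / δ := by
    rw [abs_div, abs_of_pos hδ]
    exact div_le_div_of_nonneg_right ht hδ.le
  have h3 : (1 / δ : ℝ) ≤ (⌈1 / δ⌉₊ : ℝ) := Nat.le_ceil _
  have h4 : |(round (t / δ) : ℝ)| ≤ (⌈1 / δ⌉₊ : ℝ) + 1 := by linarith
  have h5 : ((|round (t / δ)| : ℤ) : ℝ) ≤ (((⌈1 / δ⌉₊ : ℤ) + 1 : ℤ) : ℝ) := by
    push_cast
    exact h4
  exact_mod_cast h5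

/-- **`g_{ε²}` takes `O_ε(1)` values** (Tao 2016, §2): for `‖z‖ ≤ 1` and `δ > 0`, the nearest
site of `ℤ²` to `z/δ` lies in the box `[-K, K]²`, `K = ⌈1/δ⌉ + 1` (which has `(2K+1)²`
elements, `Literature.Probability.LatticeModels.card_box`).
[cite: TaoFMP2016, §2 (paragraph after the proof of Proposition 2.6: "it takes at most O_ε(1) values")] -/
theorem nearestSite_mem_box {δ : ℝ} (hδ : 0 < δ) {z : ℂ} (hz : ‖z‖ ≤ 1) :
    nearestSite δ z ∈ box 2 (⌈1 / δ⌉₊ + 1) := by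
  rw [mem_box]
  have hre : |z.re| ≤ 1 := (Complex.abs_re_le_norm z).trans hz
  have him : |z.im| ≤ 1 := (Complex.abs_im_le_norm z).trans hz
  have h0 := abs_round_div_le hδ hre
  have h1 := abs_round_div_le hδ him
  rw [abs_le] at h0 h1
  intro i
  fin_cases i
  · simp only [nearestSite, Fin.zero_eta, Matrix.cons_val_zero]
    push_cast
    exact ⟨h0.1, h0.2⟩
  · simp only [nearestSite, Fin.mk_one, Matrix.cons_val_one, Matrix.cons_val_zero]
    push_cast
    exact ⟨h1.1, h1.2⟩

/-- **`g_{ε²}` is bounded in magnitude by `O(1)`** (Tao 2016, §2): `‖δ·[z/δ]‖ ≤ ‖z‖ + δ`, from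
`dist_meshPoint_nearestSite_le`.
[cite: TaoFMP2016, §2 (paragraph after the proof of Proposition 2.6: "bounded in magnitude by O(1)")] -/
theorem norm_meshPoint_nearestSite_le {δ : ℝ} (hδ : 0 < δ) (z : ℂ) :
    ‖meshPoint δ (nearestSite δ z)‖ ≤ ‖z‖ + δ := by
  have h := dist_meshPoint_nearestSite_le hδ z
  rw [Complex.dist_eq] at h
  have : meshPoint δ (nearestSite δ z) = z + (meshPoint δ (nearestSite δ z) - z) := by ring
  rw [this]
  exact (norm_add_le _ _).trans (by linarith)

end Tao2016

end Literature.NumberTheory.LFunctions
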